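import Mathlib
import Summits.Ventures.PercRepro2.ZeroEdge
import Summits.Ventures.PercRepro2.ZeroEdges
import Summits.Ventures.PercRepro2.ParallelMerge
import Summits.Ventures.PercRepro2.StarHClass

/-!
# THE SINGLE-VERTEX THEOREM: (HMF), hence (HCOV), whenever every edge at `a₃` joins `a₃` to a mark
(blind cell PercRepro2, night-1 g13; NIGHT1-G13.md §2)

Two steps on top of the hub class theorem `StarH.HMF_star_h` (a₃ adjacent exactly to `a₁`, `a₂`,
`o`, `b` by four distinct edges).
* `HMF_star_h_multi`: the hub with ANY multiplicities — every edge at `a₃` joins `a₃` to one of the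
  four marks, one representative edge of each kind named: the extra parallel edges are merged into
  their representatives (`merge_all_rep`, Finset induction on `ParallelMerge.HMF_merge_iff`; the
  representative-map form of StarMulti's `merge_all`), the merged-away weight-`0` edges deleted
  (`ZeroEdges.HMF_ext_iff`), and the hub theorem applied on the kept edges.
* `HMF_star_marks`: NO representatives needed — adjoin the four representative edges with weight `0`
  (`ZeroEdge`, four times; they are automatically distinct), apply `HMF_star_h_multi`, transport
  back (`ZeroEdge.HMF_ext_iff`).  So: **(HMF) and (HCOV) hold at every vertex `a₃` all of whose
  edges join it to `{a₁, a₂, o, b}`** — any multiplicities, any subset of the marks (including none: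
  `a₃` isolated), every weight vector, `G − a₃` arbitrary, no hypothesis on coincidences among
  `a₁, a₂, o, b`.  This is the whole single-vertex table of the S3 (C4) pendant map in one statement.
-/

open scoped Classical

namespace Summit.Ventures.PercRepro2

namespace StarH

section MergeRep

variable {V : Type*} {E : Type*} [DecidableEq E] [Fintype V] [DecidableEq V]
  {R : Type*} [Field R] [LinearOrder R] [IsStrictOrderedRing R]

variable (ends : E → Sym2 V) (o a₁ a₂ a₃ b : V)

/-- **Merging a finset of extra edges into their representatives**: each `e ∈ S` is parallel to
`rep e ∉ S`; the result vanishes on `S`, agrees with `p` off `S` and off the representatives, and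
has the same (HMF) status. -/
theorem merge_all_rep [Fintype E] (S : Finset E) (rep : E → E)
    (hS : ∀ e ∈ S, rep e ∉ S ∧ rep e ≠ e ∧ ends (rep e) = ends e) :
    ∀ p : E → R, IsProbVec p → ∃ p' : E → R, IsProbVec p' ∧ (∀ e ∈ S, p' e = 0) ∧
      (∀ e, e ∉ S → (∀ e' ∈ S, e ≠ rep e') → p' e = p e) ∧
      (HMF p ends o a₁ a₂ a₃ b ↔ HMF p' ends o a₁ a₂ a₃ b) := by
  induction S using Finset.induction_on with
  | empty =>
    intro p hp
    exact ⟨p, hp, fun e he => absurd he (Finset.notMem_empty e), fun _ _ _ => rfl, Iff.rfl⟩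
  | insert e S' he ih =>
    intro p hp
    obtain ⟨hrS, hrne, hrpar⟩ := hS e (Finset.mem_insert_self e S')
    have hS'' : ∀ e' ∈ S', rep e' ∉ S' ∧ rep e' ≠ e' ∧ ends (rep e') = ends e' := fun e' he' =>
      ⟨fun h => (hS e' (Finset.mem_insert_of_mem he')).1 (Finset.mem_insert_of_mem h),
        (hS e' (Finset.mem_insert_of_mem he')).2.1, (hS e' (Finset.mem_insert_of_mem he')).2.2⟩
    set p₁ := Function.update (Function.update p (rep e) (1 - (1 - p (rep e)) * (1 - p e))) e 0
      with hp₁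
    have hp₁p : IsProbVec p₁ := ParallelMerge.isProbVec_merge p ends hrne hrpar hp
    have hiff : HMF p ends o a₁ a₂ a₃ b ↔ HMF p₁ ends o a₁ a₂ a₃ b :=
      ParallelMerge.HMF_merge_iff p ends hrne hrpar o a₁ a₂ a₃ b
    obtain ⟨p', hp', hz, hagree, hiff'⟩ := ih hS'' p₁ hp₁p
    refine ⟨p', hp', ?_, ?_, hiff.trans hiff'⟩
    · intro e' he'
      rcases Finset.mem_insert.1 he' with rfl | he'
      · -- the merged edge keeps its weight `0`: it is in no later merge and is no representative
        have hnr : ∀ e'' ∈ S', e' ≠ rep e'' := fun e'' he'' h =>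
          (hS e'' (Finset.mem_insert_of_mem he'')).1 (h ▸ Finset.mem_insert_self e' S')
        rw [hagree e' he hnr, hp₁, Function.update_self]
      · exact hz e' he'
    · intro e' he' hnr
      have he'' : e' ∉ S' := fun h => he' (Finset.mem_insert_of_mem h)
      have hnr' : ∀ e'' ∈ S', e' ≠ rep e'' := fun e'' he'' => hnr e'' (Finset.mem_insert_of_mem he'')
      have hee : e' ≠ e := fun h => he' (h ▸ Finset.mem_insert_self e S')
      have her : e' ≠ rep e := hnr e (Finset.mem_insert_self e S')
      rw [hagree e' he'' hnr', hp₁, Function.update_of_ne hee, Function.update_of_ne her]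

end MergeRep

section Multi

variable {V : Type*} {E : Type*} [Fintype E] [DecidableEq E] [Fintype V] [DecidableEq V]
  {R : Type*} [Field R] [LinearOrder R] [IsStrictOrderedRing R]

variable (p : E → R) (ends : E → Sym2 V) {f₁ f₂ f₃ f₄ : E} {a₃ a₁ a₂ o b : V}

/-- **The hub with any number of parallel edges**: (HMF) whenever every edge at `a₃` joins `a₃` to
`a₁`, `a₂`, `o` or `b` (one representative edge of each kind named, the four distinct). -/
theorem HMF_star_h_multi (hp : IsProbVec p) (hf₁ : ends f₁ = s(a₃, a₁)) (hf₂ : ends f₂ = s(a₃, a₂))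
    (hf₃ : ends f₃ = s(a₃, o)) (hf₄ : ends f₄ = s(a₃, b))
    (hstar : ∀ e, a₃ ∈ ends e → ends e = s(a₃, a₁) ∨ ends e = s(a₃, a₂) ∨ ends e = s(a₃, o) ∨
      ends e = s(a₃, b))
    (h31 : a₃ ≠ a₁) (h32 : a₃ ≠ a₂) (h3o : a₃ ≠ o) (h3b : a₃ ≠ b) (h12 : f₁ ≠ f₂) (h13 : f₁ ≠ f₃)
    (h14 : f₁ ≠ f₄) (h23 : f₂ ≠ f₃) (h24 : f₂ ≠ f₄) (h34 : f₃ ≠ f₄) : HMF p ends o a₁ a₂ a₃ b := by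
  -- the extra edges of the star (the edges at `a₃` other than the four coins) and their representatives
  set S : Finset E := Finset.univ.filter (fun e => a₃ ∈ ends e ∧ e ≠ f₁ ∧ e ≠ f₂ ∧ e ≠ f₃ ∧ e ≠ f₄)
    with hSdef
  have hmemS : ∀ e, e ∈ S ↔ a₃ ∈ ends e ∧ e ≠ f₁ ∧ e ≠ f₂ ∧ e ≠ f₃ ∧ e ≠ f₄ := by
    intro e; rw [hSdef]; simp
  set rep : E → E := fun e => if ends e = s(a₃, a₁) then f₁ else if ends e = s(a₃, a₂) then f₂
    else if ends e = s(a₃, o) then f₃ else if ends e = s(a₃, b) then f₄ else e with hrep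
  -- the four representatives are not extras
  have hf₁S : f₁ ∉ S := fun h => ((hmemS f₁).1 h).2.1 rfl
  have hf₂S : f₂ ∉ S := fun h => ((hmemS f₂).1 h).2.2.1 rfl
  have hf₃S : f₃ ∉ S := fun h => ((hmemS f₃).1 h).2.2.2.1 rfl
  have hf₄S : f₄ ∉ S := fun h => ((hmemS f₄).1 h).2.2.2.2 rfl
  have hS : ∀ e ∈ S, rep e ∉ S ∧ rep e ≠ e ∧ ends (rep e) = ends e := by
    intro e he
    obtain ⟨hmem, hne₁, hne₂, hne₃, hne₄⟩ := (hmemS e).1 he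
    by_cases h1 : ends e = s(a₃, a₁)
    · have : rep e = f₁ := by rw [hrep]; simp only [if_pos h1]
      rw [this]; exact ⟨hf₁S, Ne.symm hne₁, hf₁.trans h1.symm⟩
    by_cases h2 : ends e = s(a₃, a₂)
    · have : rep e = f₂ := by rw [hrep]; simp only [if_neg h1, if_pos h2]
      rw [this]; exact ⟨hf₂S, Ne.symm hne₂, hf₂.trans h2.symm⟩
    by_cases h3 : ends e = s(a₃, o)
    · have : rep e = f₃ := by rw [hrep]; simp only [if_neg h1, if_neg h2, if_pos h3]
      rw [this]; exact ⟨hf₃S, Ne.symm hne₃, hf₃.trans h3.symm⟩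
    have h4 : ends e = s(a₃, b) := by
      have hh : ends e = s(a₃, a₁) ∨ ends e = s(a₃, a₂) ∨ ends e = s(a₃, o) ∨ ends e = s(a₃, b) :=
        hstar e hmem
      rcases hh with h | h | h | h
      · exact absurd h h1
      · exact absurd h h2
      · exact absurd h h3
      · exact h
    have : rep e = f₄ := by rw [hrep]; simp only [if_neg h1, if_neg h2, if_neg h3, if_pos h4]
    rw [this]; exact ⟨hf₄S, Ne.symm hne₄, hf₄.trans h4.symm⟩
  obtain ⟨p', hp', hz, -, hiff⟩ := merge_all_rep ends o a₁ a₂ a₃ b S rep hS p hp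
  rw [hiff]
  have h0 : ∀ e, ¬ (e ∉ S) → p' e = 0 := fun e h => hz e (not_not.1 h)
  rw [ZeroEdges.HMF_ext_iff p' ends h0]
  refine HMF_star_h (ZeroEdges.pR (fun e => e ∉ S) p') (ZeroEdges.endsR (fun e => e ∉ S) ends)
    (ZeroEdges.isProbVec_pR hp') (f₁ := ⟨f₁, hf₁S⟩) (f₂ := ⟨f₂, hf₂S⟩) (f₃ := ⟨f₃, hf₃S⟩)
    (f₄ := ⟨f₄, hf₄S⟩) hf₁ hf₂ hf₃ hf₄ ?_ h31 h32 h3o h3b (fun h => h12 (congrArg Subtype.val h))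
    (fun h => h13 (congrArg Subtype.val h)) (fun h => h14 (congrArg Subtype.val h))
    (fun h => h23 (congrArg Subtype.val h)) (fun h => h24 (congrArg Subtype.val h))
    (fun h => h34 (congrArg Subtype.val h))
  rintro ⟨e, he⟩ h3
  have h3' : a₃ ∈ ends e := h3
  by_contra hne
  apply he
  rw [hmemS]
  refine ⟨h3', ?_, ?_, ?_, ?_⟩
  · intro h; exact hne (Or.inl (Subtype.ext h))
  · intro h; exact hne (Or.inr (Or.inl (Subtype.ext h)))
  · intro h; exact hne (Or.inr (Or.inr (Or.inl (Subtype.ext h))))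
  · intro h; exact hne (Or.inr (Or.inr (Or.inr (Subtype.ext h))))

/-- (HCOV) for the hub with parallel edges. -/
theorem HCov_star_h_multi (hp : IsProbVec p) (hf₁ : ends f₁ = s(a₃, a₁)) (hf₂ : ends f₂ = s(a₃, a₂))
    (hf₃ : ends f₃ = s(a₃, o)) (hf₄ : ends f₄ = s(a₃, b))
    (hstar : ∀ e, a₃ ∈ ends e → ends e = s(a₃, a₁) ∨ ends e = s(a₃, a₂) ∨ ends e = s(a₃, o) ∨
      ends e = s(a₃, b))
    (h31 : a₃ ≠ a₁) (h32 : a₃ ≠ a₂) (h3o : a₃ ≠ o) (h3b : a₃ ≠ b) (h12 : f₁ ≠ f₂) (h13 : f₁ ≠ f₃)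
    (h14 : f₁ ≠ f₄) (h23 : f₂ ≠ f₃) (h24 : f₂ ≠ f₄) (h34 : f₃ ≠ f₄) :
    CovForm.HCov p ends o a₁ a₂ a₃ b :=
  HCov_of_HMF p hp ends o a₁ a₂ a₃ b (HMF_star_h_multi p ends hp hf₁ hf₂ hf₃ hf₄ hstar h31 h32 h3o
    h3b h12 h13 h14 h23 h24 h34)

end Multi

section All

variable {V : Type*} {E : Type*} [Fintype E] [DecidableEq E] [Fintype V] [DecidableEq V]
  {R : Type*} [Field R] [LinearOrder R] [IsStrictOrderedRing R]

variable (p : E → R) (ends : E → Sym2 V) {a₃ a₁ a₂ o b : V}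

/-- **THE SINGLE-VERTEX THEOREM — (HMF) whenever every edge at `a₃` joins `a₃` to one of the marks
`a₁, a₂, o, b`** (any multiplicities, any subset of the marks, `a₃` isolated included; no
representatives, no coincidence hypotheses). -/
theorem HMF_star_marks (hp : IsProbVec p)
    (hstar : ∀ e, a₃ ∈ ends e → ends e = s(a₃, a₁) ∨ ends e = s(a₃, a₂) ∨ ends e = s(a₃, o) ∨
      ends e = s(a₃, b))
    (h31 : a₃ ≠ a₁) (h32 : a₃ ≠ a₂) (h3o : a₃ ≠ o) (h3b : a₃ ≠ b) : HMF p ends o a₁ a₂ a₃ b := by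
  rw [← ZeroEdge.HMF_ext_iff p ends s(a₃, a₁)]
  rw [← ZeroEdge.HMF_ext_iff (ZeroEdge.p' p) (ZeroEdge.ends' ends s(a₃, a₁)) s(a₃, a₂)]
  rw [← ZeroEdge.HMF_ext_iff (ZeroEdge.p' (ZeroEdge.p' p))
    (ZeroEdge.ends' (ZeroEdge.ends' ends s(a₃, a₁)) s(a₃, a₂)) s(a₃, o)]
  rw [← ZeroEdge.HMF_ext_iff (ZeroEdge.p' (ZeroEdge.p' (ZeroEdge.p' p)))
    (ZeroEdge.ends' (ZeroEdge.ends' (ZeroEdge.ends' ends s(a₃, a₁)) s(a₃, a₂)) s(a₃, o)) s(a₃, b)]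
  refine HMF_star_h_multi _ _
    (ZeroEdge.isProbVec_p' (ZeroEdge.isProbVec_p' (ZeroEdge.isProbVec_p' (ZeroEdge.isProbVec_p' hp))))
    (f₁ := some (some (some none))) (f₂ := some (some none)) (f₃ := some none) (f₄ := none)
    rfl rfl rfl rfl ?_ h31 h32 h3o h3b (by simp) (by simp) (by simp) (by simp) (by simp) (by simp)
  intro e he
  cases e with
  | none => exact Or.inr (Or.inr (Or.inr rfl))
  | some e =>
    cases e with
    | none => exact Or.inr (Or.inr (Or.inl rfl))
    | some e =>
      cases e with
      | none => exact Or.inr (Or.inl rfl)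
      | some e =>
        cases e with
        | none => exact Or.inl rfl
        | some e => exact hstar e he

/-- **THE SINGLE-VERTEX THEOREM at (HCOV) strength**: (HCOV) whenever every edge at `a₃` joins `a₃`
to one of the marks `a₁, a₂, o, b`. -/
theorem HCov_star_marks (hp : IsProbVec p)
    (hstar : ∀ e, a₃ ∈ ends e → ends e = s(a₃, a₁) ∨ ends e = s(a₃, a₂) ∨ ends e = s(a₃, o) ∨
      ends e = s(a₃, b))
    (h31 : a₃ ≠ a₁) (h32 : a₃ ≠ a₂) (h3o : a₃ ≠ o) (h3b : a₃ ≠ b) :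
    CovForm.HCov p ends o a₁ a₂ a₃ b :=
  HCov_of_HMF p hp ends o a₁ a₂ a₃ b (HMF_star_marks p ends hp hstar h31 h32 h3o h3b)

end All

end StarH

end Summit.Ventures.PercRepro2
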